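import Summits.ResolutionOfSingularities.ResolutionOfSingularities.Theorems.HilbertSamuelEliminationSigmaMaxModificationsCorridor3SigmaTameLowSncAssembly
import HarnessLib

/-!
# [OURS · L1 W4.2] TAME-LOW row T-L4 «SNC PHASE, lineage-local» — part 6: THE SNC-PHASE RANK — a well-founded rank in `ℕ ×ₗ (ℕ ×ₗ ℕ)`
# that DROPS STRICTLY AT EVERY POINT BLOW-UP OF A NON-SNC LINEAGE POINT and is absorbed by snc (the TAME-LOW fuel coordinates of
# RULING v3.14-48 (PD)(vi): `Σ δ` of the singular branches, then the tangency excess, then the crowding)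
# (cell res-hironaka, LADDER-RESOLUTION rung L; slot W4.2, crux chain w42 `SigmaMaxModificationsCorridor3` stmt-ResolutionOfSingularities-19249 /
# crux `SigmaMaxModifications` stmt-…-18506; res-L1-w42-plan-1 RULING v3.14-48 (PD)(iv)/(vi)/(PF) row T-L4 → res-L1-w42-stub-4 (gen 7);
# `--supports stmt-ResolutionOfSingularities-19249 --as helper`; consumer: res-D-pv-002 (`GroupRankReadingAny` / `TameLowFuel`: read the snc-phase
# coordinates as `ℕ ×ₗ (ℕ ×ₗ ℕ)` — this file's `sncRank`), res-L1-type-o1 (`TameLowPrescription`: «lineage point while … snc fails»))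

HONEST FRAMING.  OURS bookkeeping for the TAME-LOW tier, on top of parts 2b, 3, 4e, 5. Nothing here is a statement of H. Hironaka's manuscript
[Hironaka2017] (CANDIDATE, never a premise) nor of Cossart–Jannsen–Saito; no named fact; every theorem PROVED. AI-written; weaker than expert review.

* `singRank P B n = Σ_i [ (B i).f n ∈ 𝔪² ] · (δ((B i) at stage n) + 1)` — the `δ`-invariants (Kollár §1.4) of the branches that are still
  SINGULAR at the lineage point, read through the chain of points of part 4e;
* **`sncRank P B E n = (singRank, sncDefect (config n)) ∈ ℕ ×ₗ (ℕ ×ₗ ℕ)`**;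
* `singRank_succ_le`, `singRank_succ_lt` — `singRank` never increases and drops strictly while some branch is singular;
* **`sncRank_succ_lt`** — **if `config n` is not snc at the lineage point then `sncRank (n+1) < sncRank n`**;
* **`sncAt_config_succ`** — snc is absorbing: `SncAt (config n) → SncAt (config (n+1))`.
* Appendix (for consumers): `PointLineage.strictTransforms f₀` (the strict transforms of an initial germ, by the rule), `Branch.ofGerm`.

References: J. Kollár (2007), §1.4 [Kollar2007]; The Stacks Project, Tags 0BI7, 0BIC [StacksProject].
-/

noncomputable section

set_option linter.dupNamespace false -- mandated namespace of this single-conjunct summit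

open IsLocalRing Literature.AlgebraicGeometry.Resolution
open scoped Classical

namespace Summit.ResolutionOfSingularities.ResolutionOfSingularities.Theorems.SigmaMaxModificationsCorridor3.TameLowSnc

universe u v w

variable {K : Type u} [Field K]

section Rank

variable (P : PointLineage K) {ι : Type w} [Fintype ι] {L : ι → Type v} [∀ i, Field (L i)] (B : ∀ i, P.Branch (L i))
  (E : ℕ → Finset K)

/-- The `δ`-term of branch `i` at stage `n`: `δ + 1` (read through the chain of points) if the strict transform is SINGULAR at the lineage
point (`f n ∈ 𝔪²`), else `0`. [OURS · L1 W4.2 bookkeeping] -/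
def singTerm (i : ι) (n : ℕ) : ℕ :=
  if h : (B i).fR n ∈ maximalIdeal (P.R n) ^ 2 then
    (curveDelta ((B i).chain n ((B i).passes_of_mem (Ideal.pow_le_self two_ne_zero h))).1.range (L i)).toNat + 1
  else 0

/-- **The singular rank** `Σ_i singTerm i n`. [OURS · L1 W4.2 bookkeeping] -/
def singRank (n : ℕ) : ℕ := ∑ i, singTerm P B i n

/-- **THE SNC-PHASE RANK** `(singRank, sncDefect (config n)) ∈ ℕ ×ₗ (ℕ ×ₗ ℕ)`. [OURS · L1 W4.2 bookkeeping] -/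
def sncRank (n : ℕ) : ℕ ×ₗ (ℕ ×ₗ ℕ) := toLex (singRank P B n, sncDefect (P.R n) (config P B E n))

variable {P B E}

omit [Fintype ι] in
/-- A branch not in `𝔪²` at stage `n` is a unit or a regular parameter there, hence also at stage `n + 1`; so `f (n+1) ∈ 𝔪²` forces
`f n ∈ 𝔪²`. [OURS · proved] -/
theorem mem_sq_of_mem_sq_succ (i : ι) {n : ℕ} (h : (B i).fR (n + 1) ∈ maximalIdeal (P.R (n + 1)) ^ 2) :
    (B i).fR n ∈ maximalIdeal (P.R n) ^ 2 := by
  by_contra hn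
  have hur : (B i).fR n ∉ maximalIdeal (P.R n) ∨ IsRegularBranch (P.R n) ((B i).f n) := by
    by_cases hm : (B i).fR n ∈ maximalIdeal (P.R n)
    · exact Or.inr ⟨(B i).f_mem n, hm, hn⟩
    · exact Or.inl hm
  rcases (B i).notMem_or_regular_succ hur with h1 | ⟨hf', hm', h2⟩
  · exact h1 (Ideal.pow_le_self two_ne_zero h)
  · exact h2 h

omit [Fintype ι] in
/-- **The `δ`-term never increases, and drops strictly at a singular stage.** [OURS · proved] -/
theorem singTerm_succ_le (i : ι) (n : ℕ) :
    singTerm P B i (n + 1) ≤ singTerm P B i n ∧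
      ((B i).fR n ∈ maximalIdeal (P.R n) ^ 2 → singTerm P B i (n + 1) < singTerm P B i n) := by
  by_cases h1 : (B i).fR (n + 1) ∈ maximalIdeal (P.R (n + 1)) ^ 2
  · have h0 : (B i).fR n ∈ maximalIdeal (P.R n) ^ 2 := mem_sq_of_mem_sq_succ i h1
    have hpass : (B i).Passes (n + 1) := (B i).passes_of_mem (Ideal.pow_le_self two_ne_zero h1)
    -- the germ at stage `n` is singular, so `δ` drops along the chain
    have hsing : ¬ (haveI := isLocalRing_range ((B i).chain n hpass.of_succ).1;
        IsDiscreteValuationRing ((B i).chain n hpass.of_succ).1.range) := fun hDVR =>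
      not_mem_sq_of_isDiscreteValuationRing_range (P.dim_eq n) _ ((B i).chain n hpass.of_succ).2.1
        (Ideal.pow_le_self two_ne_zero h0) hDVR h0
    have hlt := (B i).chain_succ_delta_lt n hpass hsing
    have e1 : singTerm P B i (n + 1) = (curveDelta ((B i).chain (n + 1) hpass).1.range (L i)).toNat + 1 := by
      unfold singTerm; rw [dif_pos h1]
    have e0 : singTerm P B i n = (curveDelta ((B i).chain n hpass.of_succ).1.range (L i)).toNat + 1 := by
      unfold singTerm; rw [dif_pos h0]
    rw [e1, e0]
    exact ⟨by omega, fun _ => by omega⟩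
  · have e1 : singTerm P B i (n + 1) = 0 := by unfold singTerm; rw [dif_neg h1]
    rw [e1]
    refine ⟨Nat.zero_le _, fun h0 => ?_⟩
    unfold singTerm; rw [dif_pos h0]; exact Nat.succ_pos _

/-- `singRank (n+1) ≤ singRank n`. [OURS · proved] -/
theorem singRank_succ_le (n : ℕ) : singRank P B (n + 1) ≤ singRank P B n :=
  Finset.sum_le_sum fun i _ => (singTerm_succ_le i n).1

/-- **`singRank` drops strictly while some branch is singular at the lineage point.** [OURS · proved] -/
theorem singRank_succ_lt {n : ℕ} {i : ι} (hi : (B i).fR n ∈ maximalIdeal (P.R n) ^ 2) :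
    singRank P B (n + 1) < singRank P B n :=
  Finset.sum_lt_sum (fun j _ => (singTerm_succ_le j n).1) ⟨i, Finset.mem_univ i, (singTerm_succ_le i n).2 hi⟩

omit [Fintype ι] in
/-- If no branch is singular at stage `n`, every branch is a unit or a regular parameter at all later stages. [OURS · proved] -/
theorem notMem_or_regular_of_forall_not_mem_sq {n : ℕ} (h : ∀ i, (B i).fR n ∉ maximalIdeal (P.R n) ^ 2) :
    ∀ i m, n ≤ m → (B i).fR m ∉ maximalIdeal (P.R m) ∨ IsRegularBranch (P.R m) ((B i).f m) := by
  intro i m hm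
  refine (B i).notMem_or_regular_of_le hm ?_
  by_cases hmem : (B i).fR n ∈ maximalIdeal (P.R n)
  · exact Or.inr ⟨(B i).f_mem n, hmem, h i⟩
  · exact Or.inl hmem

variable (hE0 : E 0 = ∅) (hE : ∀ n, E (n + 1) = transformAt (P.R (n + 1)) (P.x n) (E n))

include hE0 hE in
/-- **THE SNC-PHASE RANK DROPS AT EVERY NON-SNC STEP.**  For branches through the initial point, pairwise non-associated at stage `0`, and the
exceptional configuration `E`: if `config n` is not snc at the lineage point then `sncRank (n+1) < sncRank n` in `ℕ ×ₗ (ℕ ×ₗ ℕ)` (some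
branch singular ⇒ `Σ δ` drops, parts 4c/4e; all branches regular or gone ⇒ `config (n+1) = transformAt (config n)` and the snc defect drops,
parts 2b/5). [OURS · proved] -/
theorem sncRank_succ_lt (h0 : ∀ i, (B i).fR 0 ∈ maximalIdeal (P.R 0)) (hdist : ∀ i j, i ≠ j → ¬ (B i).fR 0 ∣ (B j).fR 0)
    {n : ℕ} (hn : ¬ SncAt (P.R n) (config P B E n)) : sncRank P B E (n + 1) < sncRank P B E n := by
  unfold sncRank
  rw [Prod.Lex.toLex_lt_toLex]
  by_cases hsing : ∃ i, (B i).fR n ∈ maximalIdeal (P.R n) ^ 2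
  · obtain ⟨i, hi⟩ := hsing
    exact Or.inl (singRank_succ_lt hi)
  · push Not at hsing
    right
    have hur := notMem_or_regular_of_forall_not_mem_sq hsing
    refine ⟨?_, ?_⟩
    · -- `singRank` is `0` at both stages
      have h0n : singRank P B n = 0 := Finset.sum_eq_zero fun i _ => by unfold singTerm; rw [dif_neg (hsing i)]
      have h1n : singRank P B (n + 1) = 0 := Nat.le_zero.mp (h0n ▸ singRank_succ_le n)
      rw [h0n, h1n]
    · rw [config_succ hE hur le_rfl]
      obtain ⟨hreg, hfin⟩ := config_regular_and_distinct hE0 hE h0 hdist (fun i => hur i n le_rfl)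
      exact sncDefect_transformAt_lt (P.dim_eq n) (P.dim_eq (n + 1)) (P.quadratic n) (P.x_mem_maximalIdeal n) (P.xR_ne_zero n)
        (P.blowupRing_le n) hreg hfin hn

include hE in
/-- **SNC IS ABSORBING**: `SncAt (config n) → SncAt (config (n+1))` (snc forces every branch to be regular or gone, so the configuration
evolves by `transformAt`, and part 2b's persistence applies). [OURS · proved] -/
theorem sncAt_config_succ {n : ℕ} (hs : SncAt (P.R n) (config P B E n)) : SncAt (P.R (n + 1)) (config P B E (n + 1)) := by
  have hur : ∀ i m, n ≤ m → (B i).fR m ∉ maximalIdeal (P.R m) ∨ IsRegularBranch (P.R m) ((B i).f m) := by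
    refine notMem_or_regular_of_forall_not_mem_sq fun i hi => ?_
    have hmem : (B i).f n ∈ config P B E n := mem_config_iff.mpr (Or.inl ⟨i, rfl, Ideal.pow_le_self two_ne_zero hi⟩)
    obtain ⟨hf', hm', h2⟩ := hs.2.1 _ hmem
    exact h2 hi
  rw [config_succ hE hur le_rfl]
  exact sncAt_transformAt (P.dim_eq n) (P.dim_eq (n + 1)) (P.quadratic n) (P.x_mem_maximalIdeal n) (P.xR_ne_zero n)
    (P.blowupRing_le n) hs

end Rank

/-! ## Appendix: constructing a `Branch` from an initial germ (for consumers) -/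

section Construct

/-- `g ∈ 𝔪 ^ (contactOrder 0 g).toNat` in any local ring (for `g = 0` the exponent is `0`). [OURS · proved] -/
theorem mem_pow_toNat_contactOrder_zero {A : Type u} [CommRing A] [IsLocalRing A] (g : A) :
    g ∈ maximalIdeal A ^ (contactOrder (0 : A) g).toNat := by
  have h := (le_contactOrder_iff (0 : A) g (contactOrder (0 : A) g).toNat).mp (ENat.coe_toNat_le_self _)
  rwa [Ideal.span_singleton_eq_bot.mpr rfl, bot_sup_eq] at h

variable (P : PointLineage K)

/-- **The strict transforms of an initial germ `f₀ ∈ R 0` along the lineage**: `f (n+1) = f n / (x n)^{ord f n}` (a member of `R (n+1)`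
because `f n ∈ 𝔪^{ord}` and `R n[𝔪/x n] ⊆ R (n+1)`). [OURS · L1 W4.2 bookkeeping] -/
def PointLineage.strictTransforms (f₀ : P.R 0) : (n : ℕ) → P.R n
  | 0 => f₀
  | n + 1 =>
    ⟨(PointLineage.strictTransforms f₀ n : K) / P.x n ^ (contactOrder (0 : P.R n) (PointLineage.strictTransforms f₀ n)).toNat,
      chartAdjoin_le (P.frame_eq n) (P.blowupRing_le n)
        (div_pow_mem_chartAdjoin (P.frame_eq n) (P.xR_ne_zero n) (mem_pow_toNat_contactOrder_zero _))⟩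

/-- The defining equation of the strict transforms. [OURS · proved] -/
theorem PointLineage.strictTransforms_succ (f₀ : P.R 0) (n : ℕ) :
    (P.strictTransforms f₀ (n + 1) : K) =
      (P.strictTransforms f₀ n : K) / P.x n ^ (contactOrder (0 : P.R n) (P.strictTransforms f₀ n)).toNat := rfl

/-- **A `Branch` from an initial germ and a point of it**: `f₀ ∈ R 0` non-zero with a point `θ₀ : R 0 → L`, `ker θ₀ = (f₀)`, whose image is
a local ring of `L` with module-finite normalisation (e.g. `L = Frac (R 0 ⧸ (f₀))` for a prime `f₀` of an excellent `R 0`); the strict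
transforms are `P.strictTransforms f₀`. [OURS · L1 W4.2 bookkeeping] -/
def PointLineage.Branch.ofGerm {L : Type v} [Field L] (f₀ : P.R 0) (hf₀ : f₀ ≠ 0) (θ₀ : P.R 0 →+* L)
    (hker : RingHom.ker θ₀ = Ideal.span {f₀}) (hof : IsLocalRingOf θ₀.range)
    (hfin : Module.Finite θ₀.range (integralClosure θ₀.range L)) : P.Branch L where
  f n := (P.strictTransforms f₀ n : K)
  f_mem n := (P.strictTransforms f₀ n).2
  f_zero_ne h := hf₀ (Subtype.ext h)
  f_succ n := P.strictTransforms_succ f₀ n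
  θ₀ := θ₀
  ker_θ₀ := hker
  isLocalRingOf_θ₀ := hof
  finite_θ₀ := hfin

/-- The branch `ofGerm` has strict transforms `P.strictTransforms f₀`. [OURS · proved] -/
theorem PointLineage.Branch.ofGerm_f {L : Type v} [Field L] (f₀ : P.R 0) (hf₀ : f₀ ≠ 0) (θ₀ : P.R 0 →+* L)
    (hker : RingHom.ker θ₀ = Ideal.span {f₀}) (hof : IsLocalRingOf θ₀.range)
    (hfin : Module.Finite θ₀.range (integralClosure θ₀.range L)) (n : ℕ) :
    (PointLineage.Branch.ofGerm P f₀ hf₀ θ₀ hker hof hfin).f n = (P.strictTransforms f₀ n : K) := rfl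

end Construct

end Summit.ResolutionOfSingularities.ResolutionOfSingularities.Theorems.SigmaMaxModificationsCorridor3.TameLowSnc

end
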